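import Literature.AnabelianGeometry.SemiGraphs.FiniteCoveringsComparison
import Literature.AnabelianGeometry.SemiGraphs.GraphOfAnabelioidsGalois
import Literature.AnabelianGeometry.Anabelioids.GaloisEquivalence

/-!
# Finite étale coverings: `B(𝒢) ⥤ B^cov(𝒢)` is fully faithful ([SemiAnbd] Def. 2.1 / 3.5 (i))

Sequel to `FiniteCoveringsComparison.lean`: the functor `ofBObj : B(𝒢) ⥤ B^cov(𝒢)` from the
finite étale coverings of the semi-graph of anabelioids `{B(Π_v), B(Π_e), B(b_*)}` (Def. 2.1 p. 23)
to the coverings of `𝒢` (Def. 3.5 (i) p. 37) is faithful and full, and its values are finite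
objects (`ofBObj_isFinite`); every finite object is in its essential image (`toBObjObj`,
`ofBObjIso`), so that it induces an equivalence `B(𝒢) ≌ BFinCat 𝒢` (`equivBFin`); consequently
(**[SemiAnbd] §2 p. 23 "when `𝒢` is connected, `B(𝒢)` is a connected anabelioid"**, transported)
`BFinCat 𝒢` is a Galois category for connected `𝒢` (`galoisCategory_bFinCat`).
-/

namespace Literature.AnabelianGeometry.SemiGraphs

open CategoryTheory Literature.AnabelianGeometry.Anabelioids
open Literature.AlgebraicGeometry.Frobenioids (BCat)
open scoped FintypeCatDiscrete Pointwise

universe u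

namespace ProfiniteSemiGraph

variable (𝒢 : ProfiniteSemiGraph.{u})

/-- The covering underlying a finite étale covering is a finite object of `B^cov(𝒢)`.
[cite: MochizukiSemiAnbd2006, Def 3.5(i) p.37] -/
theorem ofBObj_isFinite (X : 𝒢.toAnab.BObj) : (𝒢.ofBObj.obj X).IsFinite :=
  ⟨fun v => inferInstanceAs (Finite (X.S v).obj.V), fun e => inferInstanceAs (Finite (X.T e).obj.V)⟩

/-- `ofBObj` is faithful (a morphism of finite étale coverings is determined by its underlying maps
of fibres). [cite: MochizukiSemiAnbd2006, Def. 2.1 p.23] -/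
instance ofBObj_faithful : (𝒢.ofBObj).Faithful where
  map_injective := by
    intro X Y f g h
    refine SemiGraphOfAnabelioids.BObj.Hom.ext (funext fun v => ?_) (funext fun e => ?_)
    · have h1 := congrArg (fun F => F.fV v) h
      apply ObjectProperty.hom_ext
      apply Action.Hom.ext
      apply ConcreteCategory.hom_ext
      intro x
      exact congrArg (fun φ => φ.hom.hom x) h1
    · have h1 := congrArg (fun F => F.fE e) h
      apply ObjectProperty.hom_ext
      apply Action.Hom.ext
      apply ConcreteCategory.hom_ext
      intro x
      exact congrArg (fun φ => φ.hom.hom x) h1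

variable {𝒢} in
/-- The morphism of `B(𝒢)` with prescribed underlying morphism of coverings.
[cite: MochizukiSemiAnbd2006, Def. 2.1 p.23] -/
noncomputable def ofBObjPreimage {X Y : 𝒢.toAnab.BObj} (F : 𝒢.ofBObj.obj X ⟶ 𝒢.ofBObj.obj Y) :
    X ⟶ Y where
  fS v := ObjectProperty.homMk
    { hom := FintypeCat.homMk fun x => (F.fV v).hom.hom x
      comm := fun g => by
        apply ConcreteCategory.hom_ext
        intro x
        exact ConcreteCategory.congr_hom ((F.fV v).hom.comm g) x }
  fT e := ObjectProperty.homMk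
    { hom := FintypeCat.homMk fun x => (F.fE e).hom.hom x
      comm := fun g => by
        apply ConcreteCategory.hom_ext
        intro x
        exact ConcreteCategory.congr_hom ((F.fE e).hom.comm g) x }
  comm b v h := by
    apply ObjectProperty.hom_ext
    apply Action.Hom.ext
    apply ConcreteCategory.hom_ext
    intro x
    -- `F.comm`: `fE ≫ ψ_Y⁻¹ = ψ_X⁻¹ ≫ b^* fV` on underlying sets; evaluate at `ψ_X x`
    have hc := ConcreteCategory.congr_hom (congrArg (fun φ => φ.hom.hom) (F.comm b v h))
      ((X.ψ b v h).hom.hom.hom x)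
    -- cancellations `ψ⁻¹ (ψ x) = x`, `ψ (ψ⁻¹ y) = y`
    have h1 : (X.ψ b v h).inv.hom.hom ((X.ψ b v h).hom.hom.hom x) = x :=
      ConcreteCategory.congr_hom (congrArg (fun φ => φ.hom.hom) (X.ψ b v h).hom_inv_id) x
    have h2 : ∀ y, (Y.ψ b v h).hom.hom.hom ((Y.ψ b v h).inv.hom.hom y) = y := fun y =>
      ConcreteCategory.congr_hom (congrArg (fun φ => φ.hom.hom) (Y.ψ b v h).inv_hom_id) y
    change (Y.ψ b v h).hom.hom.hom ((F.fV v).hom.hom x) =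
      (F.fE (𝒢.graph.edgeOf b)).hom.hom ((X.ψ b v h).hom.hom.hom x)
    have hc' : (Y.ψ b v h).inv.hom.hom ((F.fE (𝒢.graph.edgeOf b)).hom.hom
        ((X.ψ b v h).hom.hom.hom x)) = (F.fV v).hom.hom x := by
      refine hc.trans ?_
      exact congrArg (fun z => (F.fV v).hom.hom z) h1
    rw [← hc', h2]

/-- `ofBObj` is full. [cite: MochizukiSemiAnbd2006, Def. 2.1 p.23] -/
instance ofBObj_full : (𝒢.ofBObj).Full where
  map_surjective F := ⟨ofBObjPreimage F, by
    refine CovHom.ext (funext fun v => ?_) (funext fun e => ?_)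
    · apply ObjectProperty.hom_ext
      apply Action.Hom.ext
      apply ConcreteCategory.hom_ext
      intro x
      rfl
    · apply ObjectProperty.hom_ext
      apply Action.Hom.ext
      apply ConcreteCategory.hom_ext
      intro x
      rfl⟩

variable {𝒢} in
/-- The finite étale covering (object of `B(𝒢)`, Def. 2.1) underlying a FINITE object of
`B^cov(𝒢)`: the same finite sets, actions and gluings. [cite: MochizukiSemiAnbd2006, Def 3.5(i) p.37] -/
noncomputable def toBObjObj (S : CovObj 𝒢) (hS : S.IsFinite) : 𝒢.toAnab.BObj :=
  haveI := hS.finite_V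
  haveI := hS.finite_E
  -- the finite continuous `Π`-set underlying an object of `B^temp(Π)` with finite underlying set
  let A : ∀ (G : Type u) [Group G] [TopologicalSpace G] [IsTopologicalGroup G] (X : BTemp G)
      [Finite X.obj.V], ContAction FintypeCat.{u} G := fun G _ _ _ X _ =>
    ⟨{ V := FintypeCat.of X.obj.V
       ρ := { toFun := fun g => FintypeCat.homMk fun x => X.obj.ρ g x
              map_one' := by
                apply ConcreteCategory.hom_ext
                intro x
                simp only [map_one]
                rfl
              map_mul' := fun g g' => by
                apply ConcreteCategory.hom_ext
                intro x
                simp only [map_mul]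
                rfl } },
      (isContinuous_iff_stabilizer_isOpen _).mpr fun x => X.property.2 x⟩
  { S := fun v => A (𝒢.Gv v) (S.SV v)
    T := fun e => A (𝒢.Ge e) (S.SE e)
    ψ := fun b v h => ObjectProperty.isoMk _
      (Action.mkIso (FintypeCat.equivEquivIso
          (((temperedAction _).ι ⋙ Action.forget _ _).mapIso (S.glue b v h)).toEquiv.symm)
        fun g => by
          apply ConcreteCategory.hom_ext
          intro x
          -- equivariance of `glue⁻¹`
          exact ConcreteCategory.congr_hom ((S.glue b v h).inv.hom.comm g) x) }

variable {𝒢} in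
/-- The covering underlying `toBObjObj S` is `S` itself (identity on all fibres).
[cite: MochizukiSemiAnbd2006, Def 3.5(i) p.37] -/
noncomputable def ofBObjIso (S : CovObj 𝒢) (hS : S.IsFinite) :
    𝒢.ofBObj.obj (toBObjObj S hS) ≅ S where
  hom :=
    { fV := fun v => ObjectProperty.homMk { hom := TypeCat.ofHom fun x => x, comm := fun _ => rfl }
      fE := fun e => ObjectProperty.homMk { hom := TypeCat.ofHom fun x => x, comm := fun _ => rfl }
      comm := fun b v h => by
        apply ObjectProperty.hom_ext
        apply Action.Hom.ext
        apply ConcreteCategory.hom_ext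
        intro x
        rfl }
  inv :=
    { fV := fun v => ObjectProperty.homMk { hom := TypeCat.ofHom fun x => x, comm := fun _ => rfl }
      fE := fun e => ObjectProperty.homMk { hom := TypeCat.ofHom fun x => x, comm := fun _ => rfl }
      comm := fun b v h => by
        apply ObjectProperty.hom_ext
        apply Action.Hom.ext
        apply ConcreteCategory.hom_ext
        intro x
        rfl }
  hom_inv_id := by
    refine CovHom.ext (funext fun v => ?_) (funext fun e => ?_) <;> rfl
  inv_hom_id := by
    refine CovHom.ext (funext fun v => ?_) (funext fun e => ?_) <;> rfl

/-- `B(𝒢) ⥤ BFinCat 𝒢`: the functor `ofBObj` lands in finite objects.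
[cite: MochizukiSemiAnbd2006, Def 3.5(i) p.37] -/
noncomputable def ofBObjFin : 𝒢.toAnab.BObj ⥤ BFinCat 𝒢 :=
  ObjectProperty.lift _ 𝒢.ofBObj 𝒢.ofBObj_isFinite

/-- `ofBObjFin` is essentially surjective: every finite object of `B^cov(𝒢)` comes from `B(𝒢)`.
[cite: MochizukiSemiAnbd2006, Def 3.5(i) p.37] -/
instance ofBObjFin_essSurj : (𝒢.ofBObjFin).EssSurj where
  mem_essImage S := ⟨toBObjObj S.obj S.property,
    ⟨(ObjectProperty.fullyFaithfulι _).preimageIso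
      ((ObjectProperty.liftCompιIso _ 𝒢.ofBObj 𝒢.ofBObj_isFinite).app _ ≪≫
        ofBObjIso S.obj S.property)⟩⟩

/-- `ofBObjFin` is faithful. [cite: MochizukiSemiAnbd2006, Def 3.5(i) p.37] -/
instance ofBObjFin_faithful : (𝒢.ofBObjFin).Faithful := by
  dsimp only [ofBObjFin]; infer_instance

/-- `ofBObjFin` is full. [cite: MochizukiSemiAnbd2006, Def 3.5(i) p.37] -/
instance ofBObjFin_full : (𝒢.ofBObjFin).Full := by
  dsimp only [ofBObjFin]; infer_instance

/-- `ofBObjFin` is an equivalence. [cite: MochizukiSemiAnbd2006, Def 3.5(i) p.37] -/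
instance ofBObjFin_isEquivalence : (𝒢.ofBObjFin).IsEquivalence where

/-- **The finite étale coverings in the two presentations agree**: `B(𝒢) ≌ BFinCat 𝒢`.
[cite: MochizukiSemiAnbd2006, Def 3.5(i) p.37] -/
noncomputable def equivBFin : 𝒢.toAnab.BObj ≌ BFinCat 𝒢 := (𝒢.ofBObjFin).asEquivalence

/-- **For a connected semi-graph of anabelioids `𝒢` (profinite presentation), the category
`BFinCat 𝒢` of finite étale coverings is a Galois category** ([SemiAnbd] §2 p. 23 "when `𝒢` is
connected, `B(𝒢)` is a connected anabelioid", via `galoisCategory_bObj` and transport along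
`equivBFin`). [cite: MochizukiSemiAnbd2006, Def. 2.1 p.23] -/
theorem galoisCategory_bFinCat (hc : 𝒢.graph.IsConnected) :
    Nonempty (GaloisCategory (BFinCat 𝒢)) := by
  haveI : GaloisCategory 𝒢.toAnab.BObj :=
    SemiGraphOfAnabelioids.galoisCategory_bObj 𝒢.toAnab ⟨hc⟩
  exact ⟨galoisCategory_of_equivalence 𝒢.equivBFin⟩

end ProfiniteSemiGraph

end Literature.AnabelianGeometry.SemiGraphs
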